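import Mathlib
import Summits.MatrixMultiplication.Statement
import Summits.MatrixMultiplication.MatrixMultiplication.Theses.WindowedCompletionRank
import Summits.MatrixMultiplication.MatrixMultiplication.Theorems.WindowedCompletionRankWeylPresentation
import Summits.MatrixMultiplication.MatrixMultiplication.Theorems.WindowedCompletionRankWeylToThesis
import Summits.MatrixMultiplication.MatrixMultiplication.Theorems.WindowedCompletionRankThesisStubKroneckerLadder
import Summits.MatrixMultiplication.MatrixMultiplication.Theorems.WindowedCompletionRankThesisStubWeylSeed

/-!
# Crux `Thesis` (stmt-MatrixMultiplication-5491) — line `registered` (Weyl seed + amplification), RESHAPED skeleton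

Route `WindowedCompletionRank`, crux #0 `Thesis` (X itself: for every `ε > 0` some `n ≥ 2`, a finite
abelian `G` with `|G| ≤ n^(2+ε)`, index maps `α β γ : [n]² → G` and a tensor `S` on `G³` with
`R(S) ≤ n^ε` such that `⟨n,n,n⟩` is a restriction of `[α b + β c = γ a]·S(γ a, α b, β c)`).

Lead: prover-line-stmt-MatrixMultiplication-5491-c2-0 (continuation of …-c1-0 and …-5491-0). This file is the lead's
copy of the registered birth skeleton `Cruxes/Thesis/Lines/birth_WindowedCompletionRank.lean`
(sha 6c378480…a97e, stubs `stub_weylSeed`, `stub_gainAmplifies`) RESHAPED at the skeleton level: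
the amplification stub `stub_gainAmplifies : WeylBeatsTrivial → WeylCompletion` is split into

* `stub_kroneckerLadder` (PROVED + LANDED, p146897, `Theorems/WindowedCompletionRankThesisStubKroneckerLadder.lean`,
  `…Theorems.Thesis.stub_kroneckerLadder`): Kronecker powers of cocycle completions are cocycle
  completions — a completion `S` of the clock-and-shift cocycle `ζ_m^{g₂·h₁}` on `((ℤ_m^k)²)³` with
  `R(S) ≤ c` yields, for every `j`, a completion of the cocycle on `((ℤ_m^{jk})²)³` with `R ≤ c^j`
  (the cocycle is multiplicative over the `j` blocks of coordinates `Fin (j*k) ≃ Fin j × Fin k`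
  because `exp(2πi·v.val/m)` is additive in `v : ZMod m`; the rank bound is Bläser 2013 Lemma 5.8
  iterated, `tensorRank_kroneckerPow_le`, transported along the block re-indexing by
  `tensorRank_reindex`). In exponent terms: a seed `(m,k,c)` gives `θ := log_{m^k} c` at EVERY level
  `jk` — the Weyl-frame exponent never increases under powering.
* `stub_amplify` (OPEN — the heart of the line, ω = 2-strength): a ladder with `c < m^k`
  (i.e. `θ < 1` at all levels `jk`) upgrades to `WeylCompletion` (for every `δ > 0` some level with
  `R ≤ m^(δk)`, i.e. `θ → 0`). Kronecker powers alone keep `θ` constant, so the content is a strict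
  quantitative improvement under powering at every scale (route header "SecondGain", iterated; any
  margin law `θ_{2k} ≤ θ_k − η·θ_k(1−θ_k)` would do). No mechanism is known; this stub is where the
  line's bet sits, stated now with an explicit, provable-to-reach hypothesis.

`stub_weylSeed` (BY NAME the route's rank-4 crux `WeylBeatsTrivial`, item stmt-MatrixMultiplication-5494) is
PROVED + LANDED by lead c2 (p171230, witness at `(m,k,c) = (2,3,7)` over `ℤ[ζ₈]`); it was: finite and
certifiable; equivalently — the form in which the lead's compute campaign searches — functions
`f_i g_i h_i : (ℤ_m^k)² → ℂ`, `i < c = m^k − 1`, with `Σ_i h_i(a+b) f_i(a) g_i(b) = ζ_m^{a₂·b₁}`).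

`Thesis_of` composes the three stub SIGNATURES into the crux BY NAME with a real proof: the seed
`(m, k, S)` with `c := R(S) < m^k` feeds the ladder (hypothesis `R(S) ≤ c` by `le_rfl`), the ladder's
family is exactly the hypothesis of `stub_amplify`, which returns `WeylCompletion`; the LANDED
presentation `weylPresentation_proof` (stmt-5498) and glue `weylToThesis_proof` (stmt-5499) turn
`WeylCompletion` into `Thesis`.

Disproof used: none exists for this crux (`ledger crux ls stmt-MatrixMultiplication-5491`,
2026-08-17: no `Disproof.lean`). Landed negative calibrations (refuter, `Theorems/Thesis/Negative/
WindowedCompletionRank{NoSingleLevel,ForcedInjectivity}.lean`: the `ε = 0` level and the `∃∀` swap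
are false, `α β γ` injective and `n² ≤ |G|` forced) are consistent with all three stubs: the Weyl
frame has `|G| = n²` exactly and bijective index maps, and the family `δ → 0` is quantified inside
`WeylCompletion`.
-/

set_option linter.dupNamespace false

namespace Summit.MatrixMultiplication.MatrixMultiplication.Cruxes.Thesis.WindowedCompletionRankBirth

open Summit.MatrixMultiplication.MatrixMultiplication.Theses.WindowedCompletionRank
open Summit.MatrixMultiplication.MatrixMultiplication.Theorems

/-- STUB 1 — the SEED, BY NAME the route's rank-4 crux `WeylBeatsTrivial` (stmt-MatrixMultiplication-5494):
`∃ m ≥ 2, ∃ k ≥ 1, ∃ S` on `((ℤ_m^k)²)³` with `S (g+h) g h = ζ_m^{g₂·h₁}` for all `g h` and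
`R(S) < m^k` — some completion of the clock-and-shift cocycle beats the trivial one. -/
theorem stub_weylSeed :
    Summit.MatrixMultiplication.MatrixMultiplication.Theses.WindowedCompletionRank.WeylBeatsTrivial :=
  -- LANDED (p171230): Theorems/WindowedCompletionRankThesisStubWeylSeed.lean — explicit witness at (m,k,c) = (2,3,7)
  -- (⟨8,8,8⟩ = seven free three-qubit-Pauli orbits, values in ℤ[ζ₈]; 4096 identities by `decide +kernel`).
  Summit.MatrixMultiplication.MatrixMultiplication.Theorems.Thesis.stub_weylSeed

/-- STUB 2 — KRONECKER LADDER (provable): a completion of the clock-and-shift cocycle on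
`((ℤ_m^k)²)³` of rank `≤ c` gives, for every `j`, a completion of the cocycle on `((ℤ_m^{jk})²)³` of
rank `≤ c^j` (the `j`-th Kronecker power, re-indexed along `Fin (j*k) ≃ Fin j × Fin k`; the cocycle
`exp(2πi (Σ_i g₂ᵢ h₁ᵢ).val / m)` is multiplicative over blocks, the rank bound is Bläser 2013
Lemma 5.8 iterated). -/
theorem stub_kroneckerLadder :
    ∀ (m k c : ℕ), 2 ≤ m →
      (∃ S : ((Fin k → ZMod m) × (Fin k → ZMod m)) → ((Fin k → ZMod m) × (Fin k → ZMod m)) →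
          ((Fin k → ZMod m) × (Fin k → ZMod m)) → ℂ,
        (∀ g h : (Fin k → ZMod m) × (Fin k → ZMod m),
          S (g + h) g h = Complex.exp (2 * Real.pi * Complex.I * ((∑ i, g.2 i * h.1 i).val : ℂ) / m)) ∧
        Literature.Computability.AlgebraicComplexity.tensorRank S ≤ c) →
      ∀ j : ℕ,
        ∃ S : ((Fin (j * k) → ZMod m) × (Fin (j * k) → ZMod m)) →
            ((Fin (j * k) → ZMod m) × (Fin (j * k) → ZMod m)) →
            ((Fin (j * k) → ZMod m) × (Fin (j * k) → ZMod m)) → ℂ,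
          (∀ g h : (Fin (j * k) → ZMod m) × (Fin (j * k) → ZMod m),
            S (g + h) g h = Complex.exp (2 * Real.pi * Complex.I * ((∑ i, g.2 i * h.1 i).val : ℂ) / m)) ∧
          Literature.Computability.AlgebraicComplexity.tensorRank S ≤ c ^ j :=
  -- LANDED (p146897): Theorems/WindowedCompletionRankThesisStubKroneckerLadder.lean
  Summit.MatrixMultiplication.MatrixMultiplication.Theorems.Thesis.stub_kroneckerLadder

/-- STUB 3 — AMPLIFY (OPEN, the heart of the line): a Kronecker ladder of cocycle completions with
base `c < m^k` — completions of the clock-and-shift cocycle on `((ℤ_m^{jk})²)³` of rank `≤ c^j` for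
every `j`, i.e. Weyl-frame exponent `θ = log_{m^k} c < 1` at all levels `jk` — upgrades to the Weyl
completion family `WeylCompletion` (rank `≤ m^(δk)` for every `δ > 0` at some level and modulus,
i.e. `θ → 0`). Powering keeps `θ` constant; the stub asserts strict improvement under powering at
every scale (route "SecondGain", iterated). -/
theorem stub_amplify :
    (∃ m : ℕ, 2 ≤ m ∧ ∃ k : ℕ, 1 ≤ k ∧ ∃ c : ℕ, c < m ^ k ∧ ∀ j : ℕ,
      ∃ S : ((Fin (j * k) → ZMod m) × (Fin (j * k) → ZMod m)) →
          ((Fin (j * k) → ZMod m) × (Fin (j * k) → ZMod m)) →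
          ((Fin (j * k) → ZMod m) × (Fin (j * k) → ZMod m)) → ℂ,
        (∀ g h : (Fin (j * k) → ZMod m) × (Fin (j * k) → ZMod m),
          S (g + h) g h = Complex.exp (2 * Real.pi * Complex.I * ((∑ i, g.2 i * h.1 i).val : ℂ) / m)) ∧
        Literature.Computability.AlgebraicComplexity.tensorRank S ≤ c ^ j) →
    Summit.MatrixMultiplication.MatrixMultiplication.Theses.WindowedCompletionRank.WeylCompletion := by
  sorry

/-- COMPOSITION (real proof, no `sorry` of its own): the three stub SIGNATURES imply the crux `Thesis`
BY NAME. The seed `(m, k, S)` with `c := R(S) < m^k` enters the ladder (with the bound `R(S) ≤ c` by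
reflexivity); the ladder family is literally the hypothesis of the amplification stub, which yields
`WeylCompletion`; the landed clock-and-shift presentation (`weylPresentation_proof`, stmt-5498) and the
landed Weyl glue (`weylToThesis_proof`, stmt-5499) turn that family into `Thesis`. -/
theorem Thesis_of :
    Summit.MatrixMultiplication.MatrixMultiplication.Theses.WindowedCompletionRank.WeylBeatsTrivial →
    (∀ (m k c : ℕ), 2 ≤ m →
      (∃ S : ((Fin k → ZMod m) × (Fin k → ZMod m)) → ((Fin k → ZMod m) × (Fin k → ZMod m)) →
          ((Fin k → ZMod m) × (Fin k → ZMod m)) → ℂ,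
        (∀ g h : (Fin k → ZMod m) × (Fin k → ZMod m),
          S (g + h) g h = Complex.exp (2 * Real.pi * Complex.I * ((∑ i, g.2 i * h.1 i).val : ℂ) / m)) ∧
        Literature.Computability.AlgebraicComplexity.tensorRank S ≤ c) →
      ∀ j : ℕ,
        ∃ S : ((Fin (j * k) → ZMod m) × (Fin (j * k) → ZMod m)) →
            ((Fin (j * k) → ZMod m) × (Fin (j * k) → ZMod m)) →
            ((Fin (j * k) → ZMod m) × (Fin (j * k) → ZMod m)) → ℂ,
          (∀ g h : (Fin (j * k) → ZMod m) × (Fin (j * k) → ZMod m),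
            S (g + h) g h = Complex.exp (2 * Real.pi * Complex.I * ((∑ i, g.2 i * h.1 i).val : ℂ) / m)) ∧
          Literature.Computability.AlgebraicComplexity.tensorRank S ≤ c ^ j) →
    ((∃ m : ℕ, 2 ≤ m ∧ ∃ k : ℕ, 1 ≤ k ∧ ∃ c : ℕ, c < m ^ k ∧ ∀ j : ℕ,
      ∃ S : ((Fin (j * k) → ZMod m) × (Fin (j * k) → ZMod m)) →
          ((Fin (j * k) → ZMod m) × (Fin (j * k) → ZMod m)) →
          ((Fin (j * k) → ZMod m) × (Fin (j * k) → ZMod m)) → ℂ,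
        (∀ g h : (Fin (j * k) → ZMod m) × (Fin (j * k) → ZMod m),
          S (g + h) g h = Complex.exp (2 * Real.pi * Complex.I * ((∑ i, g.2 i * h.1 i).val : ℂ) / m)) ∧
        Literature.Computability.AlgebraicComplexity.tensorRank S ≤ c ^ j) →
      Summit.MatrixMultiplication.MatrixMultiplication.Theses.WindowedCompletionRank.WeylCompletion) →
    Summit.MatrixMultiplication.MatrixMultiplication.Theses.WindowedCompletionRank.Thesis := by
  intro hSeed hLadder hAmplify
  -- the Weyl-frame completion family, from seed + ladder through the amplification stub
  have hFamily : WeylCompletion := by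
    apply hAmplify
    obtain ⟨m, hm, k, hk, S, hS, hlt⟩ := hSeed
    exact ⟨m, hm, k, hk, Literature.Computability.AlgebraicComplexity.tensorRank S, hlt,
      hLadder m k _ hm ⟨S, hS, le_rfl⟩⟩
  -- the clock-and-shift presentation (landed, 5498) and the Weyl glue (landed, 5499)
  exact weylToThesis_proof weylPresentation_proof hFamily

/-- The crux BY NAME from the registered stubs (`sorry` enters only through `stub_*`). -/
theorem Thesis_closed :
    Summit.MatrixMultiplication.MatrixMultiplication.Theses.WindowedCompletionRank.Thesis :=
  Thesis_of stub_weylSeed stub_kroneckerLadder stub_amplify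

end Summit.MatrixMultiplication.MatrixMultiplication.Cruxes.Thesis.WindowedCompletionRankBirth
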